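import Mathlib.MeasureTheory.Integral.Bochner.Basic
import Mathlib.MeasureTheory.Integral.Lebesgue.Basic
import Literature.Analysis.FunctionSpaces.FlatTorus
import Literature.Analysis.FunctionSpaces.TorusCalculus
import Literature.Analysis.FunctionSpaces.TorusTestFunction
import Literature.Analysis.FunctionSpaces.TorusFluidGlue
import HarnessLib

/-!
# Weak solutions of the passive-vector (`α`, `β = 1`) model on the flat torus

Definitions only (no statements).  The one-parameter family of LINEAR incompressible models obtained from
the Navier–Stokes equations linearised at a prescribed divergence-free carrier `b`,
`∂ₜw + (b·∇)w + A (w·∇)b + ∇π = ν Δw`, `∇·w = 0`,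
is written in print by Yoshida–Kaneda, Phys. Rev. E 63 (2000) 016308, §II eq. (4)–(5):
`∂ₜũ + (v·∇)ũ − νΔũ = −α(ũ·∇)v − β∇p̃ + f̃`, `∇·ũ = 0`, "(α, β) = (1, 1)" being the linearised
Navier–Stokes equations; `(α, β) = (0, 1)` is the PASSIVE SOLENOIDAL VECTOR ("randomly advected solenoidal
vector field", loc. cit. title/abstract; the "linear pressure model" of the turbulence literature) and
`β = 0`, `α = 0` the componentwise passive scalar.  Sign dictionary: the stretching coefficient below is
`A = α` of Yoshida–Kaneda with `β = 1` (pressure kept, i.e. Leray-projected dynamics).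
Weak formulation: test against smooth DIVERGENCE-FREE space–time fields `Ψ` (this eliminates `π`); for
`∇·b = 0`, `∫⟪(b·∇)w, Ψ⟫ = −∫⟪w, (b·∇)Ψ⟫`, and for `∇·w = 0`, `∫⟪(w·∇)b, Ψ⟫ = −∫⟪b, (w·∇)Ψ⟫`, so only
`b ∈ L^∞` (no derivative of `b`) is needed.  The bookkeeping fields copy the accepted scalar notion
`Torus.IsWeakScalarTransportOn` (`Literature.Analysis.FluidPDE.PassiveScalar`).
Motivation (cell `ad-ideate`, seat ad-p1, D-0059 rung F-D1): the rung leaf `PassiveSolenoidalAnomaly`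
(anomalous dissipation for `A = 0`, the Armstrong–Vicol mechanism with the Leray projector) is typed over
this notion.
-/

open MeasureTheory Set Filter Topology
open scoped InnerProductSpace ENNReal NNReal

noncomputable section

namespace Literature.Analysis.FluidPDE.Torus

variable {d : Type*} [Fintype d] [DecidableEq d]

/-- Weak solutions on `[0,T)` of the passive-vector model with stretching coefficient `A`
(Yoshida–Kaneda 2000, eq. (4)–(5) with `(α, β) = (A, 1)`):
`∂ₜw + (b·∇)w + A (w·∇)b + ∇π = ν Δw`, `∇·w = 0`, `w(0) = w₀` on `T^d` — `A = 1`: Navier–Stokes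
linearised at `b`; `A = 0`: passive solenoidal vector; the pressure is eliminated by testing against smooth
divergence-free space–time fields `Ψ` vanishing near `t = T` (`Torus.IsSpaceTimeTest T`).
Bookkeeping as in `Torus.IsWeakScalarTransportOn`: measurability of the lifts, `w ∈ L^∞(0,T; L²)`,
`b ∈ L¹(0,T; L²)`, `|b||w| ∈ L¹((0,T) × T^d)`, `b(t)` and `w(t)` weakly divergence free for a.e. `t`.
No `L²_t H¹_x` regularity is built in (a consequence for `ν > 0`, `b ∈ L^∞`).
[cite: YoshidaKaneda2000, §II eq. (4)-(5) ((α,β)=(1,1) linearised NS; solenoidal-vector model)] -/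
structure IsWeakPassiveVectorOn (A : ℝ) (T ν : ℝ) (b : ℝ → UnitAddTorus d → EuclideanSpace ℝ d)
    (w₀ : UnitAddTorus d → EuclideanSpace ℝ d) (w : ℝ → UnitAddTorus d → EuclideanSpace ℝ d) :
    Prop where
  /-- `w` is a.e. strongly measurable on `(0,T) × T^d` (through the space–time lift). -/
  aestronglyMeasurable :
    AEStronglyMeasurable (FunctionSpaces.Torus.stLift w) (volume.restrict (Ioo 0 T ×ˢ univ))
  /-- `b` is a.e. strongly measurable on `(0,T) × T^d` (through the space–time lift). -/
  aestronglyMeasurable_carrier :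
    AEStronglyMeasurable (FunctionSpaces.Torus.stLift b) (volume.restrict (Ioo 0 T ×ˢ univ))
  /-- `w ∈ L^∞(0,T; L²(T^d))`: `∫ ‖w(t)‖² ≤ C` for a.e. `t ∈ (0,T)`. -/
  ae_lintegral_sq_le : ∃ C : ℝ≥0, ∀ᵐ t ∂(volume.restrict (Ioo 0 T)), ∫⁻ x, ‖w t x‖ₑ ^ 2 ≤ C
  /-- `b ∈ L¹(0,T; L²(T^d))`. -/
  lintegral_carrier_lt_top : ∫⁻ t in Ioo 0 T, (∫⁻ x, ‖b t x‖ₑ ^ 2) ^ (1 / 2 : ℝ) < ∞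
  /-- `|b| |w| ∈ L¹((0,T) × T^d)` (so that both transport terms make sense). -/
  lintegral_mul_lt_top : ∫⁻ t in Ioo 0 T, ∫⁻ x, ‖b t x‖ₑ * ‖w t x‖ₑ < ∞
  /-- `∇·b(t) = 0` weakly, for a.e. `t ∈ (0,T)`. -/
  ae_isWeaklyDivFree_carrier :
    ∀ᵐ t ∂(volume.restrict (Ioo 0 T)), FunctionSpaces.Torus.IsWeaklyDivFree (b t)
  /-- `∇·w(t) = 0` weakly, for a.e. `t ∈ (0,T)`. -/
  ae_isWeaklyDivFree : ∀ᵐ t ∂(volume.restrict (Ioo 0 T)), FunctionSpaces.Torus.IsWeaklyDivFree (w t)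
  /-- The weak formulation with datum, divergence-free vector tests:
  `∫₀ᵀ∫ (⟪w, ∂ₜΨ + (b·∇)Ψ + νΔΨ⟫ + A ⟪b, (w·∇)Ψ⟫) + ∫⟪w₀, Ψ(0)⟫ = 0`. -/
  weak_eq : ∀ Ψ : ℝ → UnitAddTorus d → EuclideanSpace ℝ d, FunctionSpaces.Torus.IsSpaceTimeTest T Ψ →
    (∀ t, FunctionSpaces.Torus.IsDivFree (Ψ t)) →
    (∫ t in Ioo 0 T, ∫ x, (⟪w t x, FunctionSpaces.Torus.timeDeriv Ψ t x +
          FunctionSpaces.Torus.convect (b t) (Ψ t) x + ν • FunctionSpaces.Torus.laplacian (Ψ t) x⟫_ℝ +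
        A * ⟪b t x, FunctionSpaces.Torus.convect (w t) (Ψ t) x⟫_ℝ)) +
      ∫ x, ⟪w₀ x, Ψ 0 x⟫_ℝ = 0

/-- The squared `L²` norm `‖v‖²_{L²} = ∫_{T^d} ‖v‖²` of a vector field (twice
`Torus.kineticEnergy`). [folklore] -/
def vectorL2Sq (v : UnitAddTorus d → EuclideanSpace ℝ d) : ℝ :=
  ∫ x, ‖v x‖ ^ 2

/-- The extended dissipation `ν ∫ₐᵇ ‖∇w(t)‖²_{L²} dt ∈ [0, ∞]` of a time-dependent vector field, with the
spectral `Torus.eGradNormSq` and a lower Lebesgue time integral (no junk value; twin of the scalar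
`Torus.eScalarDissipation`). [folklore] -/
def eVectorDissipation (ν : ℝ) (w : ℝ → UnitAddTorus d → EuclideanSpace ℝ d) (a b : ℝ) : ℝ≥0∞ :=
  ENNReal.ofReal ν * ∫⁻ t in Ioo a b, FunctionSpaces.Torus.eGradNormSq (w t)

end Literature.Analysis.FluidPDE.Torus

end
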